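/-
Copyright (c) 2026 the pub-hodgecm-mathlib formalisation cell (harness21).  Prover seat hodgecm-mathlib-F0P3a-p01 (g37), FLOOR 0, SUPPORTS-ONLY on h413; β-BOARD v1
(assembler's gap cell A′, tower 2): the glued strata `![2ρ+s, 2ρ, 2ρ+s]` OFF the glue foot and ABOVE `min(n₁, n₃)` are EMPTY (swap transport of ★ p861495).  2026-09-04.
-/
import Summits.HodgeConjecture.HodgeConjecture.Theorems.F0P3cDyRamLabelledOddGluedOffFootHigh   -- ★ p861495 (this seat): tower-1 cell A′ `depths_of_mem_stratum_G1_offFoot`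
import Summits.HodgeConjecture.HodgeConjecture.Theorems.F0P3cDyRamLabelledOddPureStrataG2      -- ★ p860856 (LH4-p11 (g8)): brings the §P transport kit (`image_mapGL_stratum`, `isElementDatum_swap`, `coe_conj_eq_diagonal`)
import HarnessLib

/-!
# Crux `H413`, line LH4 «(D-RAM) FOUR-FRAME» — (β-BAL) Stage B, the `hRest` coverage cell A′ FOR TOWER 2: OFF THE GLUE FOOT (`n₂ ≠ n₁ + s`), a glued stratum
# `![2ρ+s, 2ρ, 2ρ+s]` with `min(n₁, n₃) < 2ρ` has NO member, so its clean-shell labelled-odd table is `0`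

Cell `hodgecm-mathlib` (D-0151), FLOOR 0, crux item H413 = `stmt-HodgeConjecture-24833`, route `HCCMUnconditional`; squad F0∕P3c∕LH4.  THEOREMS ONLY (no `def`, no instance, no
notation, no `sorry`, default heartbeats); ★-only imports; lane `--supports stmt-HodgeConjecture-24833 --as helper` (count-neutral); pays NO row, states NO law.

THE MATHEMATICS.  The (0 1)-swap transport of ★ p860856 §1: a member of the tower-2 stratum `(2ρ+s, 2ρ, 2ρ+s)` of `𝓛₀(diag(α, β, 1))` is `mapGL P M′` for a member `M′` of the tower-1
stratum `(2ρ, 2ρ+s, 2ρ+s)` of `𝓛₀(diag(β, α, 1))` (★ `image_mapGL_stratum`, ★ `coe_conj_eq_diagonal`), and `(β, α; n₂, n₁, n₃)` is an element datum (★ `isElementDatum_swap`);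
so ★ p861495 `depths_of_mem_stratum_G1_offFoot` at the swapped datum gives `2ρ + s ≤ n₂ ∧ 2ρ ≤ n₁ ∧ 2ρ ≤ n₃` off the foot `n₂ ≠ n₁ + s`.  Hence `min(n₁, n₃) < 2ρ` leaves the stratum
EMPTY and every cut table over it vanishes — cell (5) of the tower-2 rest partition for the dispatcher `restValue_G2_of_rows`.
HONEST LABEL.  Count-neutral helper (an EMPTY cell, value `0`); R6∕R7∕R8, `hRest`, (T3), `hbox`, (β-BAL), (β), T₊ remain OPEN; `HC_CM` is proved only modulo the 7 printed
citations (2 remaining named inputs: hLiu418 = `stmt-HodgeConjecture-24832`, h413 = `stmt-HodgeConjecture-24833`) until rung 0 closes.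

## References
* [Kottwitz1986BaseChangeUnits] R. E. Kottwitz, *Base change for unit elements of Hecke algebras*, Compositio Math. 60 (1986), §1 pp. 240–241 (lattice counts by strata; stability).
* [Serre1980Trees] J.-P. Serre, *Trees*, Springer (1980), Ch. II §1.1 (lattices `g·𝒪^N`, Hermite normal forms).
* [Rogawski1990] J. D. Rogawski, *Automorphic Representations of Unitary Groups in Three Variables*, Ann. of Math. Stud. 123 (1990), §4.9 Prop. 4.9.1 (a)(b) p. 55.
-/

set_option autoImplicit false

noncomputable section

namespace Summit.HodgeConjecture.HodgeConjecture.Cruxes.H413.F0P3cDyRamLabelledOddGluedOffFootHighG2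

open Literature.NumberTheory.Automorphic Literature.NumberTheory.Automorphic.HermitianLattice
open Literature.NumberTheory.Automorphic.UnitaryLatticeTree Literature.NumberTheory.Automorphic.UnitaryThreeFourFrame
open Summit.HodgeConjecture.HodgeConjecture.Cruxes.H413.F0P3cDyRamFourFramePieces
open Summit.HodgeConjecture.HodgeConjecture.Cruxes.H413.F0P3cDyRamFourFrameCensusDefs
open Summit.HodgeConjecture.HodgeConjecture.Cruxes.H413.F0P3cDyRamDiagonalTorusDefs
open Summit.HodgeConjecture.HodgeConjecture.Cruxes.H413.F0P3cDyRamDiagonalStrataDefs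
open Summit.HodgeConjecture.HodgeConjecture.Cruxes.H413.F0P3cDyRamLabelledOddCountDefs
open Summit.HodgeConjecture.HodgeConjecture.Cruxes.H413.F0P3cDyRamDiagonalPermutation
open Summit.HodgeConjecture.HodgeConjecture.Cruxes.H413.F0P3cDyRamLabelledOddGluedOffFootHigh (depths_of_mem_stratum_G1_offFoot)
open scoped Valued WithZero Matrix MatrixGroups

variable {K : Type} [Field K] [Valued K ℤᵐ⁰] {σ : K →+* K} {ϖ : K} {d t : ℕ} {α β : K} {N₀ n₁ n₂ n₃ : ℕ}

/-! ## §1  Off the foot, the depths of a tower-2 glued member (swap transport) -/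

/-- **OFF THE GLUE FOOT `n₂ ≠ n₁ + s`, EVERY MEMBER OF THE STRATUM `(2ρ+s, 2ρ, 2ρ+s)` HAS `2ρ + s ≤ n₂`, `2ρ ≤ n₁` AND `2ρ ≤ n₃`** (★ p861495 at the swapped element datum
through the §P transport).  No cell, read or token hypothesis. [cite: Kottwitz1986BaseChangeUnits, §1 pp. 240–241] [cite: Serre1980Trees, Ch. II §1.1] -/
theorem depths_of_mem_stratum_G2_offFoot (hD : IsRamifiedQuadraticDatum σ ϖ d t) (hE : IsElementDatum σ ϖ N₀ α β n₁ n₂ n₃)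
    (T : GL (Fin 3) K) (hT : (T : Matrix (Fin 3) (Fin 3) K) = Matrix.diagonal ![α, β, 1]) {ρ s : ℕ} (hρ : 1 ≤ ρ) (hs : 1 ≤ s) (hfoot : n₂ ≠ n₁ + s)
    {M : Submodule 𝒪[K] (Fin 3 → K)} (hM : M ∈ stratum σ ϖ T ![2 * ρ + s, 2 * ρ, 2 * ρ + s]) :
    2 * ρ + s ≤ n₂ ∧ 2 * ρ ≤ n₁ ∧ 2 * ρ ≤ n₃ := by
  have hE' := isElementDatum_swap hE
  obtain ⟨P, hP⟩ := exists_gl_coe_eq_permMatrix (K := K) (Equiv.swap (0 : Fin 3) 1)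
  have ha : (![2 * ρ + s, 2 * ρ, 2 * ρ + s] : Fin 3 → ℕ) ∘ ⇑(Equiv.swap (0 : Fin 3) 1).symm = ![2 * ρ, 2 * ρ + s, 2 * ρ + s] := by
    ext i; fin_cases i <;> rfl
  have hd : (![α, β, 1] : Fin 3 → K) ∘ ⇑(Equiv.swap (0 : Fin 3) 1).symm = ![β, α, 1] := by
    ext i; fin_cases i <;> rfl
  have hT'' : ((P⁻¹ * T * P : GL (Fin 3) K) : Matrix (Fin 3) (Fin 3) K) = Matrix.diagonal ![β, α, 1] := by rw [coe_conj_eq_diagonal P hP T hT, hd]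
  have himg := image_mapGL_stratum σ ϖ P hP T (![2 * ρ + s, 2 * ρ, 2 * ρ + s] : Fin 3 → ℕ)
  rw [ha] at himg
  rw [← himg] at hM
  obtain ⟨M', hM', -⟩ := hM
  exact depths_of_mem_stratum_G1_offFoot hD hE' (P⁻¹ * T * P) hT'' hρ hs hfoot hM'

/-- **A′ (tower 2) · OFF THE GLUE FOOT AND ABOVE `min(n₁, n₃)` THE STRATUM `(2ρ+s, 2ρ, 2ρ+s)` IS EMPTY.** [cite: Kottwitz1986BaseChangeUnits, §1 pp. 240–241] [cite: Serre1980Trees, Ch. II §1.1] -/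
theorem stratum_G2_eq_empty_of_offFoot_of_lt (hD : IsRamifiedQuadraticDatum σ ϖ d t) (hE : IsElementDatum σ ϖ N₀ α β n₁ n₂ n₃)
    (T : GL (Fin 3) K) (hT : (T : Matrix (Fin 3) (Fin 3) K) = Matrix.diagonal ![α, β, 1]) {ρ s : ℕ} (hρ : 1 ≤ ρ) (hs : 1 ≤ s) (hfoot : n₂ ≠ n₁ + s)
    (hlt : min n₁ n₃ < 2 * ρ) : stratum σ ϖ T ![2 * ρ + s, 2 * ρ, 2 * ρ + s] = ∅ := by
  refine Set.eq_empty_iff_forall_notMem.2 fun M hM => ?_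
  obtain ⟨-, h2, h3⟩ := depths_of_mem_stratum_G2_offFoot hD hE T hT hρ hs hfoot hM
  exact absurd (le_min h2 h3) (not_le.2 hlt)

/-! ## §2  Hence every cut table over it vanishes -/

/-- **ANY CUT, ANY WEIGHT: `Σᶠ_{M ∈ stratum (2ρ+s, 2ρ, 2ρ+s), Q M} f M = 0` OFF THE FOOT ABOVE `min(n₁, n₃)`.** [cite: Kottwitz1986BaseChangeUnits, §1 pp. 240–241] -/
theorem finsum_stratum_G2_sep_eq_zero_of_offFoot_of_lt (hD : IsRamifiedQuadraticDatum σ ϖ d t) (hE : IsElementDatum σ ϖ N₀ α β n₁ n₂ n₃)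
    (T : GL (Fin 3) K) (hT : (T : Matrix (Fin 3) (Fin 3) K) = Matrix.diagonal ![α, β, 1]) {ρ s : ℕ} (hρ : 1 ≤ ρ) (hs : 1 ≤ s) (hfoot : n₂ ≠ n₁ + s)
    (hlt : min n₁ n₃ < 2 * ρ) (Q : Submodule 𝒪[K] (Fin 3 → K) → Prop) (f : Submodule 𝒪[K] (Fin 3 → K) → ℚ) :
    ∑ᶠ M ∈ {M : Submodule 𝒪[K] (Fin 3 → K) | M ∈ stratum σ ϖ T ![2 * ρ + s, 2 * ρ, 2 * ρ + s] ∧ Q M}, f M = 0 := by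
  have hempty : {M : Submodule 𝒪[K] (Fin 3 → K) | M ∈ stratum σ ϖ T ![2 * ρ + s, 2 * ρ, 2 * ρ + s] ∧ Q M} = ∅ := by
    refine Set.eq_empty_iff_forall_notMem.2 fun M hM => ?_
    have h := hM.1
    rw [stratum_G2_eq_empty_of_offFoot_of_lt hD hE T hT hρ hs hfoot hlt] at h
    exact h
  rw [hempty, finsum_mem_empty]

/-! ## §3  β-BOARD common shape: cell A′ of the tower-2 `hRest` partition -/

/-- **A′ (tower 2) · β-BOARD COMMON SHAPE — OFF THE FOOT (`n₂ ≠ n₁ + s`), ABOVE `min(n₁, n₃)` (`min n₁ n₃ < 2ρ`): the clean-shell labelled-odd table of the stratum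
`(2ρ+s, 2ρ, 2ρ+s)` is `0`** in every slot, for any label and any square level. [cite: Kottwitz1986BaseChangeUnits, §1 pp. 240–241] [cite: Rogawski1990, §4.9 Prop. 4.9.1 (a)(b) p. 55] -/
theorem finsum_stratum_G2_shell_labelledOdd_div_relIndex_eq_zero_of_offFoot_of_lt (hD : IsRamifiedQuadraticDatum σ ϖ d t)
    (hE : IsElementDatum σ ϖ N₀ α β n₁ n₂ n₃) (T : GL (Fin 3) K) (hT : (T : Matrix (Fin 3) (Fin 3) K) = Matrix.diagonal ![α, β, 1])
    (ρ s : ℕ) (hρ : 1 ≤ ρ) (hs : 1 ≤ s) (hfoot : n₂ ≠ n₁ + s) (hlt : min n₁ n₃ < 2 * ρ) (ℓ₂ : ℕ) (i : Fin 3)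
    (Λ : Submodule 𝒪[K] (Fin 3 → K) → (Fin 3 → K) → Prop) :
    ∑ᶠ M ∈ {M : Submodule 𝒪[K] (Fin 3 → K) | M ∈ stratum σ ϖ T ![2 * ρ + s, 2 * ρ, 2 * ρ + s] ∧
        (LatticeInLevel ϖ (d % 2) (Matrix.diagonal ![α - 1, β - 1, 0]) M ∧ ¬ LatticeInLevel ϖ (d % 2 + 1) (Matrix.diagonal ![α - 1, β - 1, 0]) M ∧
          LatticeInLevel ϖ ℓ₂ (Matrix.diagonal ![(α - 1) * (α - 1), (β - 1) * (β - 1), 0]) M)},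
      (labelledOddCount σ ϖ 0 i Λ M : ℚ) / ((((unitStabilizer M).map (unitNormMap σ 3)).relIndex (fixedUnitTorus σ 3) : ℕ) : ℚ) = 0 :=
  finsum_stratum_G2_sep_eq_zero_of_offFoot_of_lt hD hE T hT hρ hs hfoot hlt _ _

end Summit.HodgeConjecture.HodgeConjecture.Cruxes.H413.F0P3cDyRamLabelledOddGluedOffFootHighG2

end
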